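import Summits.BirchSwinnertonDyer.BirchSwinnertonDyer.Theorems.PrintCFramBottomClassIndexLawFiveLeKummerRadicalCharacter
import HarnessLib

/-!
# Route `PrintCFram`, crux C2 `BottomClassIndexLawFiveLe` (stmt-BirchSwinnertonDyer-20372), line
# `eisenstein-resource-bdp-line` (B1 first-order census, CASE R): **THE CLASS RADICAL** — an `e`-eigenclass `x ≠ 1` of
# `Cl_K[p]` yields an EXACT `e`-eigen-radical `α ∈ 𝓞_K` (`σα = α^{e σ} y_σ^p`), `(α) = 𝔟^p` with `[𝔟] = x^{|G|} ≠ 1`, hence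
# `α ∉ E_K · K^{×p}`, and for every place `v` a representative `αγ^p ∈ 𝓞_K ∖ v` (so its Kummer character kills the inertia
# above every `v ∤ p`) — the second radical of the Leopoldt lower bound «EVEN-IRREGULAR ⟹ #R_rel(ψ) ≥ p²»
# (cell `bsd-print-cfram`, width seat `bsd-line-cfram-p1-w7` g4; helper `--supports` 20372; 0 defs, 0 facts, 0 sorry)

HONEST FRAMING. Nothing about BSD is proved here, no stub is closed; ideal arithmetic in a Dedekind domain and the integral
projector `∏_τ τ(α₀)^{e(τ⁻¹)}` (as in `Literature…UnitGalois.exists_even_eigenunit`, this seat). With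
`…KummerRadicalCharacter` / `…Equivariance` (this seat) the radical `α` gives an admissible `ā ē⁻¹`-isotypic character of `Γ_K`
unramified outside `p`, independent of the one coming from the Minkowski unit (`α ∉ E_K K^{×p}`); the S-relaxed LINK and the
count `#h1Unramified ≥ p²` feeding w2 g10's `SelmerCount.exists_sha_ne_zero_of_coaligned_of_sq_le` are the remaining steps.
* §1 `ideal_pow_left_injective`, `exists_repr_not_mem` (per-place `v`-unit representative of a `p`-th-power radical class).
* §2 **`exists_eigenRadical_of_eigenclass`**.
THEOREMS ONLY; no definition, no named fact, no `sorry`. BSD is not proved by any of this; no summit statement is proved by this seat.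
References: [Washington1997] §10.2 (proof of Thm. 10.9: radicals from `A[p]` and from units); [Lang1990] Ch. 13 §2 Thm. 2.1.
-/

set_option autoImplicit false
-- `…BirchSwinnertonDyer.BirchSwinnertonDyer.Theorems…` is the problem's mandated namespace (D-0017).
set_option linter.dupNamespace false

noncomputable section

namespace Summit.BirchSwinnertonDyer.BirchSwinnertonDyer.Theorems.PrintCFram.KummerRadical

open Literature.NumberTheory.NumberFields Literature.NumberTheory.GaloisRepresentations Literature.FieldTheory.Kummer
open NumberField IsDedekindDomain Field
open scoped nonZeroDivisors Pointwise

/-! ## §1 Ideal arithmetic -/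

section Ideals

variable {R : Type*} [CommRing R] [IsDedekindDomain R]

/-- `I ^ n = J ^ n` with `n ≠ 0` forces `I = J` for ideals of a Dedekind domain. [folklore] -/
theorem ideal_pow_left_injective {I J : Ideal R} {n : ℕ} (hn : n ≠ 0) (h : I ^ n = J ^ n) : I = J := by
  classical
  have hzero : ∀ {I J : Ideal R}, I ^ n = J ^ n → I = ⊥ → J = ⊥ := by
    intro I J h hI
    rw [hI, ← Ideal.zero_eq_bot, zero_pow hn] at h
    rw [← Ideal.zero_eq_bot]
    exact pow_eq_zero_iff hn |>.mp h.symm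
  by_cases hI : I = ⊥
  · rw [hI, hzero h hI]
  have hJ : J ≠ ⊥ := fun hJ => hI (hzero h.symm hJ)
  have hf := congrArg UniqueFactorizationMonoid.normalizedFactors h
  rw [UniqueFactorizationMonoid.normalizedFactors_pow, UniqueFactorizationMonoid.normalizedFactors_pow] at hf
  have hf' : UniqueFactorizationMonoid.normalizedFactors I = UniqueFactorizationMonoid.normalizedFactors J := by
    ext q
    have := congrArg (Multiset.count q) hf
    simp only [Multiset.count_nsmul] at this
    exact Nat.eq_of_mul_eq_mul_left (Nat.pos_of_ne_zero hn) this
  rw [← Ideal.prod_normalizedFactors_eq_self hI, ← Ideal.prod_normalizedFactors_eq_self hJ, hf']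

/-- In a nonzero ideal `𝔟` of a Dedekind domain there is `d ∈ 𝔟` with `(d) = 𝔟 𝔢` and `v ∤ 𝔢`, for any prime `v`
(`𝔟 v < 𝔟`). [folklore] -/
theorem exists_mem_span_eq_mul_not_dvd {𝔟 : Ideal R} (h𝔟 : 𝔟 ≠ ⊥) (v : HeightOneSpectrum R) :
    ∃ (d : R) (𝔢 : Ideal R), d ≠ 0 ∧ Ideal.span {d} = 𝔟 * 𝔢 ∧ ¬ v.asIdeal ∣ 𝔢 := by
  have hlt : 𝔟 * v.asIdeal < 𝔟 := by
    refine lt_of_le_of_ne Ideal.mul_le_right fun h => ?_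
    have h1 : 𝔟 * v.asIdeal = 𝔟 * ⊤ := by rw [h, Ideal.mul_top]
    exact v.isPrime.ne_top (mul_left_cancel₀ h𝔟 h1)
  obtain ⟨d, hd𝔟, hdv⟩ := SetLike.exists_of_lt hlt
  have hdvd : 𝔟 ∣ Ideal.span {d} := Ideal.dvd_iff_le.mpr ((Ideal.span_singleton_le_iff_mem _).mpr hd𝔟)
  obtain ⟨𝔢, h𝔢⟩ := hdvd
  have hd0 : d ≠ 0 := by
    rintro rfl
    exact hdv (Ideal.zero_mem _)
  refine ⟨d, 𝔢, hd0, h𝔢, fun hv𝔢 => hdv ?_⟩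
  have h1 : 𝔟 * v.asIdeal ∣ Ideal.span {d} := by rw [h𝔢]; exact mul_dvd_mul_left 𝔟 hv𝔢
  exact (Ideal.dvd_iff_le.mp h1) (Ideal.mem_span_singleton_self d)

/-- **A `p`-th-power radical has a `v`-unit representative at every place.** `R` Dedekind with fraction field `K`,
`α ∈ R` with `(α) = 𝔟^n` (`n ≠ 0`), `v` a prime: there are `γ ∈ K` and `a ∈ R ∖ v` with `α γ^n = a` (move `𝔟` within its class
to an ideal prime to `v`). [folklore] -/
theorem exists_repr_not_mem {K : Type*} [Field K] [Algebra R K] [IsFractionRing R K] {α : R} {𝔟 : Ideal R} {n : ℕ}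
    (h𝔟 : 𝔟 ≠ ⊥) (hα : Ideal.span {α} = 𝔟 ^ n) (v : HeightOneSpectrum R) :
    ∃ (γ : K) (a : R), a ∉ v.asIdeal ∧ algebraMap R K α * γ ^ n = algebraMap R K a := by
  classical
  -- `(d) = 𝔟 𝔢`, `v ∤ 𝔢`; `(d') = 𝔢 𝔠`, `v ∤ 𝔠`
  obtain ⟨d, 𝔢, hd0, hd, hv𝔢⟩ := exists_mem_span_eq_mul_not_dvd h𝔟 v
  have h𝔢 : 𝔢 ≠ ⊥ := by
    rintro rfl
    rw [Ideal.mul_bot, Ideal.span_singleton_eq_bot] at hd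
    exact hd0 hd
  obtain ⟨d', 𝔠, hd'0, hd', hv𝔠⟩ := exists_mem_span_eq_mul_not_dvd h𝔢 v
  -- `(α d'^n) = 𝔟^n 𝔢^n 𝔠^n = (d^n) 𝔠^n`
  have hideal : Ideal.span {α * d' ^ n} = Ideal.span {d ^ n} * 𝔠 ^ n := by
    rw [← Ideal.span_singleton_mul_span_singleton, ← Ideal.span_singleton_pow, ← Ideal.span_singleton_pow, hα, hd', hd,
      mul_pow, mul_pow]
    ring
  have hmem : α * d' ^ n ∈ Ideal.span {d ^ n} := by
    have h1 : Ideal.span {d ^ n} ∣ Ideal.span {α * d' ^ n} := by rw [hideal]; exact dvd_mul_right _ _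
    exact (Ideal.dvd_iff_le.mp h1) (Ideal.mem_span_singleton_self _)
  obtain ⟨a, ha⟩ := Ideal.mem_span_singleton'.mp hmem
  -- `(a) = 𝔠^n`, so `a ∉ v`
  have hdn0 : Ideal.span {d ^ n} ≠ 0 := by
    rw [Ne, Ideal.zero_eq_bot, Ideal.span_singleton_eq_bot]; exact pow_ne_zero _ hd0
  have haideal : Ideal.span {a} = 𝔠 ^ n := by
    have h1 : Ideal.span {d ^ n} * Ideal.span {a} = Ideal.span {d ^ n} * 𝔠 ^ n := by
      rw [Ideal.span_singleton_mul_span_singleton, mul_comm (d ^ n) a, ha, hideal]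
    exact mul_left_cancel₀ hdn0 h1
  have hav : a ∉ v.asIdeal := by
    intro hav
    have h1 : v.asIdeal ∣ Ideal.span {a} := Ideal.dvd_iff_le.mpr ((Ideal.span_singleton_le_iff_mem _).mpr hav)
    rw [haideal] at h1
    exact hv𝔠 ((Ideal.prime_of_isPrime v.ne_bot v.isPrime).dvd_of_dvd_pow h1)
  -- `γ = d'/d`
  have hdK : algebraMap R K d ≠ 0 := (map_ne_zero_iff _ (IsFractionRing.injective R K)).mpr hd0
  refine ⟨algebraMap R K d' / algebraMap R K d, a, hav, ?_⟩
  rw [div_pow, ← map_pow, ← map_pow, mul_div_assoc', div_eq_iff (by rw [map_pow]; exact pow_ne_zero _ hdK),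
    ← map_mul, ← map_mul, ← ha, mul_comm a]

end Ideals

/-! ## §2 The class radical -/

section ClassRadical

variable {K : Type} [Field K] [NumberField K] [IsGalois ℚ K] {p : ℕ} [hp : Fact p.Prime]

omit [IsGalois ℚ K] in
/-- `‖θ σ − e σ‖ < 1` read through `PadicInt.toZMod`. [folklore] -/
private theorem toZMod_eq_of_norm_lt (θ : (K ≃ₐ[ℚ] K) →* ℤ_[p]ˣ) (e : (K ≃ₐ[ℚ] K) → ℕ)
    (hθe : ∀ σ, ‖((θ σ : ℤ_[p]ˣ) : ℤ_[p]) - (e σ : ℤ_[p])‖ < 1) (σ : K ≃ₐ[ℚ] K) :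
    PadicInt.toZMod ((θ σ : ℤ_[p]ˣ) : ℤ_[p]) = (e σ : ZMod p) := by
  have hmem : ((θ σ : ℤ_[p]ˣ) : ℤ_[p]) - (e σ : ℤ_[p]) ∈ RingHom.ker (PadicInt.toZMod (p := p)) := by
    rw [PadicInt.ker_toZMod]; exact PadicInt.mem_nonunits.2 (hθe σ)
  rw [RingHom.mem_ker, map_sub, map_natCast, sub_eq_zero] at hmem
  exact hmem

omit [IsGalois ℚ K] in
/-- `e(a b) = e(a) e(b) + p k` in `ℤ`. [folklore] -/
private theorem exists_int_of_mul (θ : (K ≃ₐ[ℚ] K) →* ℤ_[p]ˣ) (e : (K ≃ₐ[ℚ] K) → ℕ)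
    (hθe : ∀ σ, ‖((θ σ : ℤ_[p]ˣ) : ℤ_[p]) - (e σ : ℤ_[p])‖ < 1) (a b : K ≃ₐ[ℚ] K) :
    ∃ k : ℤ, (e (a * b) : ℤ) = (e a : ℤ) * (e b : ℤ) + (p : ℤ) * k := by
  have h1 := toZMod_eq_of_norm_lt θ e hθe (a * b)
  have h2 : PadicInt.toZMod ((θ (a * b) : ℤ_[p]ˣ) : ℤ_[p]) = (e a : ZMod p) * (e b : ZMod p) := by
    rw [map_mul, Units.val_mul, map_mul, toZMod_eq_of_norm_lt θ e hθe a, toZMod_eq_of_norm_lt θ e hθe b]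
  have h3 : ((e (a * b) : ℤ) : ZMod p) = (((e a : ℤ) * (e b : ℤ) : ℤ) : ZMod p) := by
    push_cast; rw [← h1, h2]
  rw [ZMod.intCast_eq_intCast_iff, Int.modEq_iff_dvd] at h3
  obtain ⟨k, hk⟩ := h3
  exact ⟨-k, by linarith⟩

omit [IsGalois ℚ K] in
/-- The coercion of `intAut τ y` to `K` is `τ y`. [folklore] -/
private theorem coe_intAut (τ : K ≃ₐ[ℚ] K) (y : 𝓞 K) : ((AmbiguousClass.intAut τ y : 𝓞 K) : K) = τ (y : K) := rfl

/-- **THE CLASS RADICAL.** `K/ℚ` Galois, `p ∤ [K:ℚ]`, `θ : Gal(K/ℚ) →* ℤ_pˣ` with `θ ≡ e (mod p)`; `x ∈ Cl(𝓞 K)` an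
`e`-EIGENCLASS of order `p` (`x ≠ 1`, `x^p = 1`, `σ·x = e σ • x`). Then there is `α ∈ 𝓞 K`, `α ≠ 0`, with
(i) EXACT eigen-relations `σ α = α^{e σ} · y_σ^p` (`y_σ ∈ K`) for every `σ ∈ Gal(K/ℚ)`;
(ii) for every place `v` a representative `α γ^p = a ∈ 𝓞 K ∖ v`;
(iii) `α ∉ E_K · K^{×p}` (`α ≠ u y^p` for all units `u` and `y ∈ K`).
CONSTRUCTION: `x = [𝔞]`, `𝔞^p = (α₀)`, `α = ∏_τ τ(α₀)^{e(τ⁻¹)}`; `(α) = 𝔟^p` with `[𝔟] = x^{Σ_τ e(τ)e(τ⁻¹)} = x^{|G|} ≠ 1`.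
[cite: Washington1997, §10.2 (proof of Thm. 10.9)] [cite: Lang1990, Ch. 13 §2 Thm. 2.1 (proof)] -/
theorem exists_eigenRadical_of_eigenclass (hpK : ¬ p ∣ Module.finrank ℚ K)
    (θ : (K ≃ₐ[ℚ] K) →* ℤ_[p]ˣ) (e : (K ≃ₐ[ℚ] K) → ℕ)
    (hθe : ∀ σ, ‖((θ σ : ℤ_[p]ˣ) : ℤ_[p]) - (e σ : ℤ_[p])‖ < 1)
    (x : ClassGroup (𝓞 K)) (hx1 : x ≠ 1) (hxp : x ^ p = 1)
    (hxe : ∀ σ : K ≃ₐ[ℚ] K, classGroupRep ℚ K σ (Additive.ofMul x) = e σ • Additive.ofMul x) :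
    ∃ α : 𝓞 K, α ≠ 0 ∧
      (∀ σ : K ≃ₐ[ℚ] K, ∃ y : K, σ (α : K) = (α : K) ^ e σ * y ^ p) ∧
      (∀ v : HeightOneSpectrum (𝓞 K), ∃ (γ : K) (a : 𝓞 K), a ∉ v.asIdeal ∧ (α : K) * γ ^ p = (a : K)) ∧
      ∀ (u : (𝓞 K)ˣ) (y : K), (α : K) ≠ ((u : 𝓞 K) : K) * y ^ p := by
  classical
  have hpr : p.Prime := hp.out
  -- Step A: `x = [𝔞]`, `𝔞^p = (α₀)`
  obtain ⟨𝔞, h𝔞x⟩ := ClassGroup.mk0_surjective x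
  have h𝔞0 : (𝔞 : Ideal (𝓞 K)) ≠ ⊥ := nonZeroDivisors.ne_zero 𝔞.2
  have hpow_mem : (𝔞 : Ideal (𝓞 K)) ^ p ∈ (Ideal (𝓞 K))⁰ := pow_mem 𝔞.2 p
  have hprinc : ((𝔞 : Ideal (𝓞 K)) ^ p).IsPrincipal := by
    rw [← ClassGroup.mk0_eq_one_iff hpow_mem]
    have h : (⟨(𝔞 : Ideal (𝓞 K)) ^ p, hpow_mem⟩ : (Ideal (𝓞 K))⁰) = 𝔞 ^ p := Subtype.ext rfl
    rw [h, map_pow, h𝔞x, hxp]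
  obtain ⟨α₀, hα₀⟩ := hprinc.principal
  have hα₀' : (𝔞 : Ideal (𝓞 K)) ^ p = Ideal.span {α₀} := hα₀
  have hα₀0 : α₀ ≠ 0 := by
    intro h
    rw [h, Ideal.span_singleton_eq_bot.mpr rfl] at hα₀'
    exact pow_ne_zero _ h𝔞0 hα₀'
  have hα₀K : (α₀ : K) ≠ 0 := RingOfIntegers.coe_ne_zero_iff.mpr hα₀0
  -- Step B: the projector `α = ∏_τ τ(α₀)^{e(τ⁻¹)}`
  set α : 𝓞 K := ∏ τ : K ≃ₐ[ℚ] K, AmbiguousClass.intAut τ α₀ ^ e τ⁻¹ with hαdef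
  have hαK : (α : K) = ∏ τ : K ≃ₐ[ℚ] K, τ (α₀ : K) ^ e τ⁻¹ := by
    rw [hαdef]; push_cast; simp only [coe_intAut]
  have hα0 : α ≠ 0 := by
    rw [hαdef]
    exact Finset.prod_ne_zero_iff.mpr fun τ _ => pow_ne_zero _ fun h =>
      hα₀0 ((map_eq_zero_iff _ (AmbiguousClass.intAut τ).injective).mp h)
  refine ⟨α, hα0, fun σ => ?_, fun v => ?_, fun u y hy => ?_⟩
  · -- (i) exact eigen-relations
    have hk : ∀ ρ' : K ≃ₐ[ℚ] K, ∃ k : ℤ, (e (ρ'⁻¹ * σ) : ℤ) = (e ρ'⁻¹ : ℤ) * (e σ : ℤ) + (p : ℤ) * k :=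
      fun ρ' => exists_int_of_mul θ e hθe ρ'⁻¹ σ
    choose k hk using hk
    refine ⟨∏ ρ' : K ≃ₐ[ℚ] K, ρ' (α₀ : K) ^ k ρ', ?_⟩
    have hne : ∀ ρ' : K ≃ₐ[ℚ] K, ρ' (α₀ : K) ≠ 0 := fun ρ' => (map_ne_zero_iff _ ρ'.injective).mpr hα₀K
    have hstep : σ (α : K) = ∏ ρ' : K ≃ₐ[ℚ] K, ρ' (α₀ : K) ^ e (ρ'⁻¹ * σ) := by
      rw [hαK, map_prod]
      simp_rw [map_pow, ← AlgEquiv.mul_apply]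
      exact Fintype.prod_equiv (Equiv.mulLeft σ) _ _ (fun τ => by
        simp only [Equiv.coe_mulLeft, mul_inv_rev, inv_mul_cancel_right])
    rw [hstep, hαK, ← Finset.prod_pow, ← Finset.prod_pow, ← Finset.prod_mul_distrib]
    refine Finset.prod_congr rfl fun ρ' _ => ?_
    rw [← zpow_natCast, ← zpow_natCast (ρ' (α₀ : K) ^ e ρ'⁻¹), ← zpow_natCast (ρ' (α₀ : K) ^ k ρ'),
      ← zpow_natCast (ρ' (α₀ : K)), ← zpow_mul, ← zpow_mul, ← zpow_add₀ (hne ρ'), hk ρ', mul_comm (k ρ') (p : ℤ)]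
  · -- (ii) `v`-unit representatives: `(α) = 𝔟^p`
    have hspan : Ideal.span {α} = (∏ τ : K ≃ₐ[ℚ] K,
        ((𝔞 : Ideal (𝓞 K)).map (AmbiguousClass.intAut τ : 𝓞 K →+* 𝓞 K)) ^ e τ⁻¹) ^ p := by
      rw [hαdef, ← Ideal.prod_span_singleton, ← Finset.prod_pow]
      refine Finset.prod_congr rfl fun τ _ => ?_
      rw [← Ideal.span_singleton_pow,
        show Ideal.span {AmbiguousClass.intAut τ α₀} =
          ((𝔞 : Ideal (𝓞 K)) ^ p).map (AmbiguousClass.intAut τ : 𝓞 K →+* 𝓞 K) by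
            rw [hα₀', Ideal.map_span, Set.image_singleton]; rfl,
        Ideal.map_pow, ← pow_mul, ← pow_mul, mul_comm]
    have h𝔟0 : (∏ τ : K ≃ₐ[ℚ] K, ((𝔞 : Ideal (𝓞 K)).map (AmbiguousClass.intAut τ : 𝓞 K →+* 𝓞 K)) ^ e τ⁻¹) ≠ ⊥ := by
      rw [← Ideal.zero_eq_bot]
      exact Finset.prod_ne_zero_iff.mpr fun τ _ => pow_ne_zero _ (by
        rw [Ideal.zero_eq_bot]; exact nonZeroDivisors.ne_zero (AmbiguousClass.map_mem_nonZeroDivisors τ 𝔞))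
    obtain ⟨γ, a, hav, hγ⟩ := exists_repr_not_mem (K := K) h𝔟0 hspan v
    exact ⟨γ, a, hav, hγ⟩
  · -- (iii) `α ∉ E_K K^{×p}`: `[𝔟] = x^{|G|} ≠ 1`
    set 𝔟 : Ideal (𝓞 K) := ∏ τ : K ≃ₐ[ℚ] K, ((𝔞 : Ideal (𝓞 K)).map (AmbiguousClass.intAut τ : 𝓞 K →+* 𝓞 K)) ^ e τ⁻¹
      with h𝔟def
    have hspan : Ideal.span {α} = 𝔟 ^ p := by
      rw [hαdef, h𝔟def, ← Ideal.prod_span_singleton, ← Finset.prod_pow]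
      refine Finset.prod_congr rfl fun τ _ => ?_
      rw [← Ideal.span_singleton_pow,
        show Ideal.span {AmbiguousClass.intAut τ α₀} =
          ((𝔞 : Ideal (𝓞 K)) ^ p).map (AmbiguousClass.intAut τ : 𝓞 K →+* 𝓞 K) by
            rw [hα₀', Ideal.map_span, Set.image_singleton]; rfl,
        Ideal.map_pow, ← pow_mul, ← pow_mul, mul_comm]
    have hmem𝔟 : 𝔟 ∈ (Ideal (𝓞 K))⁰ := by
      rw [h𝔟def]
      exact prod_mem fun τ _ => pow_mem (AmbiguousClass.map_mem_nonZeroDivisors τ 𝔞) _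
    -- `mk0 𝔟 = x^{Σ e τ e τ⁻¹}`
    have hclass : ClassGroup.mk0 ⟨𝔟, hmem𝔟⟩ = x ^ ∑ τ : K ≃ₐ[ℚ] K, e τ * e τ⁻¹ := by
      have h1 : (⟨𝔟, hmem𝔟⟩ : (Ideal (𝓞 K))⁰) =
          ∏ τ : K ≃ₐ[ℚ] K, (⟨_, AmbiguousClass.map_mem_nonZeroDivisors τ 𝔞⟩ : (Ideal (𝓞 K))⁰) ^ e τ⁻¹ := by
        apply Subtype.ext
        change 𝔟 = _
        rw [h𝔟def, Submonoid.coe_finsetProd]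
        refine Finset.prod_congr rfl fun τ _ => ?_
        rw [SubmonoidClass.coe_pow]
      rw [h1, map_prod]
      have hfac : ∀ τ : K ≃ₐ[ℚ] K,
          ClassGroup.mk0 ((⟨_, AmbiguousClass.map_mem_nonZeroDivisors τ 𝔞⟩ : (Ideal (𝓞 K))⁰) ^ e τ⁻¹) =
            x ^ (e τ * e τ⁻¹) := by
        intro τ
        rw [map_pow, ← AmbiguousClass.mulEquiv_mk0 τ 𝔞, h𝔞x]
        have h2 := hxe τ
        rw [classGroupRep_apply] at h2
        have h3 : ClassGroup.mulEquiv (AmbiguousClass.intAut τ) x = x ^ e τ := by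
          have h4 := congrArg Additive.toMul h2
          rwa [toMul_ofMul, toMul_nsmul, toMul_ofMul] at h4
        rw [h3, ← pow_mul]
      simp_rw [hfac]
      exact Finset.prod_pow_eq_pow_sum _ _ _
    -- `Σ e τ e τ⁻¹ ≡ |G| (mod p)`
    have hsum : x ^ (∑ τ : K ≃ₐ[ℚ] K, e τ * e τ⁻¹) = x ^ Fintype.card (K ≃ₐ[ℚ] K) := by
      rw [pow_eq_pow_mod _ hxp, pow_eq_pow_mod (Fintype.card (K ≃ₐ[ℚ] K)) hxp]
      congr 1
      have h1 : ∀ τ : K ≃ₐ[ℚ] K, ((e τ * e τ⁻¹ : ℕ) : ZMod p) = 1 := by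
        intro τ
        rw [Nat.cast_mul, ← toZMod_eq_of_norm_lt θ e hθe τ, ← toZMod_eq_of_norm_lt θ e hθe τ⁻¹, ← map_mul,
          ← Units.val_mul, ← map_mul, mul_inv_cancel, map_one, Units.val_one, map_one]
      have h2 : ((∑ τ : K ≃ₐ[ℚ] K, e τ * e τ⁻¹ : ℕ) : ZMod p) = (Fintype.card (K ≃ₐ[ℚ] K) : ZMod p) := by
        rw [Nat.cast_sum]; simp_rw [h1]; rw [Finset.sum_const, Finset.card_univ, nsmul_eq_mul, mul_one]
      exact (ZMod.natCast_eq_natCast_iff' _ _ _).1 h2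
    have hne1 : x ^ Fintype.card (K ≃ₐ[ℚ] K) ≠ 1 := by
      intro h1
      have hcop : (Fintype.card (K ≃ₐ[ℚ] K)).gcd p = 1 := by
        rw [← Nat.card_eq_fintype_card, IsGalois.card_aut_eq_finrank]
        exact (Nat.Coprime.symm ((Nat.Prime.coprime_iff_not_dvd hpr).2 hpK))
      have h2 : x ^ (Fintype.card (K ≃ₐ[ℚ] K)).gcd p = 1 := pow_gcd_eq_one.mpr ⟨h1, hxp⟩
      rw [hcop, pow_one] at h2
      exact hx1 h2
    -- from `α = u y^p`: `𝔟 (d) = (n)`, so `[𝔟] = 1`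
    apply hne1
    rw [← hsum, ← hclass]
    obtain ⟨n, d, hd, hnd⟩ := IsFractionRing.div_surjective (A := 𝓞 K) y
    have hd0 : (d : 𝓞 K) ≠ 0 := nonZeroDivisors.ne_zero hd
    have hdK : ((d : 𝓞 K) : K) ≠ 0 := RingOfIntegers.coe_ne_zero_iff.mpr hd0
    have hrelK : (α : K) * ((d : 𝓞 K) : K) ^ p = ((u : 𝓞 K) : K) * ((n : 𝓞 K) : K) ^ p := by
      rw [hy, mul_assoc, ← mul_pow, ← hnd,
        show algebraMap (𝓞 K) K n / algebraMap (𝓞 K) K d * ((d : 𝓞 K) : K) = ((n : 𝓞 K) : K) from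
          div_mul_cancel₀ _ hdK]
    have hrel : α * d ^ p = (u : 𝓞 K) * n ^ p := by
      apply RingOfIntegers.coe_injective; push_cast; exact hrelK
    have hn0 : n ≠ 0 := by
      intro h0
      rw [h0, zero_pow hpr.ne_zero, mul_zero, mul_eq_zero] at hrel
      exact hrel.elim hα0 (fun h => hd0 ((pow_eq_zero_iff hpr.ne_zero).mp h))
    have hideal : (𝔟 * Ideal.span {(d : 𝓞 K)}) ^ p = (Ideal.span {n}) ^ p := by
      rw [mul_pow, ← hspan, Ideal.span_singleton_pow, Ideal.span_singleton_pow, Ideal.span_singleton_mul_span_singleton,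
        hrel, Ideal.span_singleton_mul_left_unit u.isUnit]
    have heq : 𝔟 * Ideal.span {(d : 𝓞 K)} = Ideal.span {n} := ideal_pow_left_injective hpr.ne_zero hideal
    have hdmem : Ideal.span {(d : 𝓞 K)} ∈ (Ideal (𝓞 K))⁰ := by
      rw [mem_nonZeroDivisors_iff_ne_zero, Ne, Ideal.zero_eq_bot, Ideal.span_singleton_eq_bot]; exact hd0
    have h1 : ClassGroup.mk0 ⟨𝔟, hmem𝔟⟩ = (ClassGroup.mk0 ⟨Ideal.span {(d : 𝓞 K)}, hdmem⟩)⁻¹ :=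
      ClassGroup.mk0_eq_mk0_inv_iff.mpr ⟨n, hn0, heq⟩
    have h2 : ClassGroup.mk0 ⟨Ideal.span {(d : 𝓞 K)}, hdmem⟩ = 1 :=
      (ClassGroup.mk0_eq_one_iff hdmem).mpr ⟨⟨d, rfl⟩⟩
    rw [h1, h2, inv_one]

end ClassRadical

end Summit.BirchSwinnertonDyer.BirchSwinnertonDyer.Theorems.PrintCFram.KummerRadical

end
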